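import Summits.BirchSwinnertonDyer.BirchSwinnertonDyer.Theorems.Rank1ResidualJetCarrierNeKitThree
import HarnessLib

/-!
# T1 JET (cell `bsd-jet`), bucket A (`q ≠ p`): SAMPLE by-name records through the kit WITHOUT a
# hypothesis at `p` — two ADDITIVE-at-`3` rows: `675i1` (no multiplicative prime at all; Frobenius
# road) and `855b1` ((ram) road at `p = 3`)

HONEST FRAMING (programme file §HONESTY, verbatim): «no tranche here proves BSD; ARM L moves the
LITERAL column of an r ≤ 1 census into the kernel-proved-modulo-named-print column». THEOREMS ONLY
(seat `bsd-jet-pv-1`, session g2; `--supports stmt-BirchSwinnertonDyer-14418`, helper). PURPOSE: the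
worked TEMPLATE (for the row generator, seat `bsd-jet-ty`) of the two roads of
`Rank1ResidualJetCarrierNeKitThree.lean` on Cremona data, every numeric step a `decide` goal — the
sub-block of bucket A that `Rank1ResidualJetCarrierNeKit.lean` ∕ `…Records01.lean` could not serve:
`p = 3` with `E` ADDITIVE at `3` (census `HOME/census-jet/jet_keys_A_classes.tsv` 4bd046410940e84e:
58 441 of 171 015 bucket-A classes).
* `(675i1, 3)`: `N = 675 = 3³·5²`, `r = 1`, Cremona model `[1, −1, 0, −117, 166]`
  (`Δ = 94921875 = 3⁵·5⁸`, `c₄ = 5625`, `j = 1875`); reduction at `3` additive `IV` (`c₃ = 1`);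
  stringent prime `q = 5` additive `IV*` (`c₅ = 3`, `ord₃ c₅ = 1 = m_max`); galrep at `3` surjective;
  lane datum `D = −11`, `ord₃ I_K = 1`. NO prime of multiplicative reduction exists, so neither the
  Serre-witness road (`p ≥ 5`), nor the Tate-line road (multiplicative at `p`), nor the (ram) road
  applies: the image input comes from THREE Frobenius witnesses — `ℓ₁ = 7` (`#Ẽ(𝔽₇) = 8`, `a = 0`,
  `X² + 7 ≡ X² + 1` irreducible mod `3`), `ℓ₂ = 37 ≡ 1 (mod 3)` (`#Ẽ(𝔽₃₇) = 33`, `a = 5 ≡ 2`, `9 ∤ 33`: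
  a Frobenius of order `3`), `ℓ₃ = 23 ≡ 5 (mod 9)` (`#Ẽ(𝔽₂₃) = 27`, `a = −3 ≡ 6 (mod 9)`: the mod-`9`
  certificate) — `bsdp_jetA_675i1_3_frobenius`.
* `(855b1, 3)`: `N = 855 = 3²·5·19`, `r = 1`, Cremona model `[1, −1, 1, 13, 474]`
  (`Δ = −98688375 = −3⁷·5³·19²`, `c₄ = −639 = −3²·71`); reduction at `3` additive `I₁*` (`c₃ = 2`);
  stringent prime `q = 5` split `I₃` (`c₅ = 3`); `19` multiplicative with `19² ∥ Δ`, `3 ∤ 2` — a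
  (ram) witness; `E[3]` irreducible by the Frobenius witness `ℓ = 11` (`#Ẽ(𝔽₁₁) = 10`, `a = 2`,
  `X² − 2X + 11 ≡ X² + X + 2` has no root mod `3`); lane datum `D = −56`, `ord₃ I_K = 1` —
  `bsdp_jetA_855b1_3_ram` (g0's `bsdp_of_jetRowCarrierNe_of_mult_of_ram` needs `3 ∤ c₄`, false here).
DISPLAYED BINDERS (not re-checked in the kernel, exactly as in every Heegner-index record of the
cell): the READING binder `hJ` (`JET.JetchevDivisibilityCarrierNe`, audit sheet
`HOME/sheets/PV1-A-BLOCK-READING.md`, referee's word pending), the published `hMcU`, `hGZK`, `hKo`,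
`hrec`, `hD36`, `hlev`; the Heegner datum (`K` with `d_K ∉ {−3, −4}`, level `N` with `5 ∣ N`,
Heegner point `P` of infinite order), the two-engine index line `ord₃ [E(K):ℤP] ≤ ord₃ c₅(E)`,
`r_an ≤ 1`, `#Ш_an` a `3`-adic unit. Nothing is booked by this file (bookings are referee A's, on
the reading and on a two-engine index line); it is a template, not an offer. PARTITION: row D5
`JET@p∣N` bucket A — 0 classes moved.

References: [Jetchev2008] Cor. 1.5 (p. 812); [Cremona2006] Table 1 (labels 675i1, 855b1);
[Serre1972] §2.4 Prop. 15, §5.2 (iii); [SerreAbelianLadic1968] IV-23 Lemma 3, A.1.2; [Elkies2006]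
Introduction; [Mazur1978] Prop. 6.3 (1); [Miller2011LMS] Def. 1.1.
-/

set_option autoImplicit false

noncomputable section

open scoped Classical

open WeierstrassCurve Literature.NumberTheory.EllipticCurves
  Literature.NumberTheory.EllipticCurves.ModularForms
  Literature.NumberTheory.EllipticCurves.Rank1Residual
  Literature.NumberTheory.EllipticCurves.Rank1Residual.X11RankOneCertificates
  Summit.BirchSwinnertonDyer.BirchSwinnertonDyer.Rank1Residual
  Summit.BirchSwinnertonDyer.BirchSwinnertonDyer.Rank1Residual.IntModel
  Summit.BirchSwinnertonDyer.BirchSwinnertonDyer.Rank1Residual.X11RankOne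
  Summit.BirchSwinnertonDyer.Rank1Residual Summit.BirchSwinnertonDyer.Rank1Residual.X11b

namespace Summit.BirchSwinnertonDyer.Rank1Residual.JET

/-- **`BSD(E,3)` for `675i1` through the bucket-A kit, Frobenius road** (`N = 675 = 3³·5²`; model
`[1,−1,0,−117,166]`, `Δ = 3⁵·5⁸`, `c₄ = 5625`; ADDITIVE (`IV`) at `3`; carrier `q = 5` additive `IV*`,
`c₅ = 3`; no multiplicative prime; `r_an = 1`; `#Ш_an = 1`). Kernel: `Δ ≠ 0`, support
`[(3,3,5),(5,2,8)]` with the Silverman disjunct at each prime, Frobenius witnesses `(7, 8)`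
irreducible mod `3`, `(37, 33)` of order `3`, `(23, 27)` the mod-`9` certificate (`23 ≡ 5`,
`a₂₃ = −3 ≡ 6 (mod 9)`). Displayed binders: `hJ` (READING), `hMcU`, `hGZK`, `hKo`, `hrec`, `hD36`,
`hlev` (published), the Heegner datum and the index line at `q = 5`. CONDITIONAL; nothing booked.
[cite: Jetchev2008, Cor. 1.5 (p. 812)] [cite: Cremona2006, Table 1 (label 675i1)]
[cite: Serre1972, §2.4 Prop. 15 and §5.2 (iii)] [cite: SerreAbelianLadic1968, Ch. IV §3.4 Lemma 3 (IV-23)] -/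
theorem bsdp_jetA_675i1_3_frobenius
    (hJ : JetchevDivisibilityCarrierNe)
    (hMcU : McCallum1991_padicValNat_card_sha_primary_add_le_of_globalDivisibility)
    (hGZK : rank_eq_analyticRank_of_analyticRank_le_one)
    (hKo : ∀ (N : ℕ) [NeZero N] (W : WeierstrassCurve ℚ) (K : Type) [Field K] [NumberField K],
      kolyvagin N W K)
    (hrec : ∀ (N : ℕ) [NeZero N] (W : WeierstrassCurve ℚ) (K : Type) [Field K] [NumberField K],
      heegnerPointOfConductor_one_galoisConj N W K)
    (hD36 : ∀ (N : ℕ) [NeZero N] (W : WeierstrassCurve ℚ) (K : Type) [Field K] [NumberField K],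
      phi_heegnerTau_mem_singularModuliField N W K)
    (hlev : ∀ {N : ℕ} [NeZero N], IsNewformOf.level_eq_conductorNorm (N := N))
    (W : WeierstrassCurve ℚ) (hW : W = ⟨1, -1, 0, -117, 166⟩)
    {N : ℕ} [NeZero N] {K : Type} [Field K] [NumberField K] (hK : IsImaginaryQuadratic K)
    (hD3 : NumberField.discr K ≠ -3) (hD4 : NumberField.discr K ≠ -4)
    (hH : SatisfiesHeegnerHypothesis N K) {P : (W.baseChange K).toAffine.Point}
    (hP : IsHeegnerPoint N W K P) (hnt : ¬ IsOfFinAddOrder P) (hqN : 5 ∣ N)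
    (hI : padicValNat 3 (AddSubgroup.zmultiples P).index ≤
      padicValNat 3 ((W.baseChange ℚ_[5]).localTamagawaNumber ℤ_[5]))
    (hr : W.analyticRank ≤ 1) {s : ℚ} (hs : shaAn W = (s : ℂ)) (hv : padicValRat 3 s = 0) :
    BSDp W 3 :=
  bsdp_of_jetRowCarrierNe_three_of_frobenius 1 (-1) 0 (-117) 166 (by decide +kernel)
    [(3, 3, 5), (5, 2, 8)]
    (by intro t ht; simp only [List.mem_cons, List.not_mem_nil, or_false] at ht
        rcases ht with rfl | rfl <;> norm_num)
    (by decide +kernel) (by decide +kernel)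
    7 37 23 (by norm_num) (by norm_num) (by norm_num) (by norm_num) (by norm_num) (by norm_num)
    (by norm_num) (by norm_num) (by decide +kernel) (by decide +kernel) (by decide +kernel)
    (n₁ := 8) (n₂ := 33) (n₃ := 27) (by decide +kernel) (by decide +kernel) (by decide +kernel)
    (by decide) (by decide) (by decide) hJ hMcU hGZK hKo hrec hD36 hlev W hW hK hD3 hD4 hH hP hnt 5
    (by norm_num) hqN (by norm_num) hI hr hs hv

/-- **`BSD(E,3)` for `855b1` through the bucket-A kit, (ram) road at an ADDITIVE `3`**
(`N = 855 = 3²·5·19`; model `[1,−1,1,13,474]`, `Δ = −3⁷·5³·19²`, `c₄ = −639`; additive (`I₁*`) at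
`3`; carrier `q = 5` split `I₃`, `c₅ = 3`; `r_an = 1`; `#Ш_an = 1`). Kernel: `Δ ≠ 0`, support
`[(3,2,7),(5,1,3),(19,1,2)]` with the Silverman disjunct at each prime, Frobenius witness `(11, 10)`
for `Irr` (`X² − 2X + 11` root-free mod `3`), (ram) witness `19` (`19 ∣ Δ`, `19 ∤ c₄`, `19² ∥ Δ`,
`3 ∤ 2`). Displayed binders as in `bsdp_jetA_675i1_3_frobenius` (index line at `q = 5`).
CONDITIONAL; nothing booked. [cite: Jetchev2008, Cor. 1.5 (p. 812)]
[cite: Cremona2006, Table 1 (label 855b1)] [cite: Mazur1978, §6 Prop. 6.3 (1) (p. 153)]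
[cite: Serre1972, §2.4 Prop. 15] [cite: SerreAbelianLadic1968, Ch. IV §3.4 Lemma 3 and A.1.2] -/
theorem bsdp_jetA_855b1_3_ram
    (hJ : JetchevDivisibilityCarrierNe)
    (hMcU : McCallum1991_padicValNat_card_sha_primary_add_le_of_globalDivisibility)
    (hGZK : rank_eq_analyticRank_of_analyticRank_le_one)
    (hKo : ∀ (N : ℕ) [NeZero N] (W : WeierstrassCurve ℚ) (K : Type) [Field K] [NumberField K],
      kolyvagin N W K)
    (hrec : ∀ (N : ℕ) [NeZero N] (W : WeierstrassCurve ℚ) (K : Type) [Field K] [NumberField K],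
      heegnerPointOfConductor_one_galoisConj N W K)
    (hD36 : ∀ (N : ℕ) [NeZero N] (W : WeierstrassCurve ℚ) (K : Type) [Field K] [NumberField K],
      phi_heegnerTau_mem_singularModuliField N W K)
    (hlev : ∀ {N : ℕ} [NeZero N], IsNewformOf.level_eq_conductorNorm (N := N))
    (W : WeierstrassCurve ℚ) (hW : W = ⟨1, -1, 1, 13, 474⟩)
    {N : ℕ} [NeZero N] {K : Type} [Field K] [NumberField K] (hK : IsImaginaryQuadratic K)
    (hD3 : NumberField.discr K ≠ -3) (hD4 : NumberField.discr K ≠ -4)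
    (hH : SatisfiesHeegnerHypothesis N K) {P : (W.baseChange K).toAffine.Point}
    (hP : IsHeegnerPoint N W K P) (hnt : ¬ IsOfFinAddOrder P) (hqN : 5 ∣ N)
    (hI : padicValNat 3 (AddSubgroup.zmultiples P).index ≤
      padicValNat 3 ((W.baseChange ℚ_[5]).localTamagawaNumber ℤ_[5]))
    (hr : W.analyticRank ≤ 1) {s : ℚ} (hs : shaAn W = (s : ℂ)) (hv : padicValRat 3 s = 0) :
    BSDp W 3 :=
  bsdp_of_jetRowCarrierNe_of_ram 3 Nat.prime_three (by norm_num) 1 (-1) 1 13 474 (by decide +kernel)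
    [(3, 2, 7), (5, 1, 3), (19, 1, 2)]
    (by intro t ht; simp only [List.mem_cons, List.not_mem_nil, or_false] at ht
        rcases ht with rfl | rfl | rfl <;> norm_num)
    (by decide +kernel) (by decide +kernel)
    11 (by norm_num) (by norm_num) (by norm_num) (by decide +kernel) (n := 10) (by decide +kernel)
    (by decide) 19 (by norm_num) (by norm_num) (by decide +kernel) (by decide +kernel) (e := 2)
    (by decide +kernel) (by decide +kernel) (by norm_num) hJ hMcU hGZK hKo hrec hD36 hlev W hW hK hD3
    hD4 hH hP hnt 5 (by norm_num) hqN (by norm_num) hI hr hs hv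

end Summit.BirchSwinnertonDyer.Rank1Residual.JET

end
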